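import Summits.CriticalPhenomena.CardyFormulaZ2.Theorems.CardyBoundaryCoulombGasHalfPlaneMarkDensityLawBoxExhaustionPart1

/-!
# Box exhaustion for the collinear half-plane Cardy statement, part 2: discrete arcs of the box

Support file (line `Sketch`, stub `stub_collinearCardy`, crux `HalfPlaneMarkDensityLaw`,
stmt-CriticalPhenomena-5661; transfer `RectilinearCardy → stub_collinearCardy`), continuing part 1
(the box `Ioo (-K) K ×ℂ Ioo 0 H`, `meshDomain = meshVertices` for it):

* the discrete arc (`discreteArc`, Smirnov 2001 §2: boundary vertices of `Ω_δ` at least as close to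
  the arc as to the rest of `∂Ω`) of a bottom segment `[s₀, s₁] × {0}`
  (`{z | z.im = 0 ∧ z.re ∈ Icc s₀ s₁}`) is EXACTLY the row `{(m, 1) : s₀ ≤ δ m ≤ s₁}` when the
  segment stays `δ` away from the corners and `2δ < H`
  (`discreteArc_boxDomain_subset`, `mem_discreteArc_boxDomain`);
* open paths of `Ω_δ` are open lattice paths inside the lattice box and conversely
  (`openConnIn_meshDomain_of_reachable`, `reachable_of_openConnIn_boxDomain`).
-/

noncomputable section

namespace Summit.CriticalPhenomena.CardyFormulaZ2.Cruxes.HalfPlaneMarkDensityLaw.SketchLine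

open Set Metric Complex
open Literature.Probability.LatticeModels Literature.Probability.Percolation

variable {K H δ : ℝ}

namespace BoxExhaustion

/-! ## The bottom segment -/

/-- The bottom segment as the image of a real interval. [folklore] -/
theorem bseg_eq_image (s₀ s₁ : ℝ) :
    {z : ℂ | z.im = 0 ∧ z.re ∈ Icc s₀ s₁} = ((↑) : ℝ → ℂ) '' Icc s₀ s₁ := by
  ext z
  simp only [mem_setOf_eq, mem_image]
  constructor
  · rintro ⟨him, hre⟩
    exact ⟨z.re, hre, Complex.ext (by simp) (by simp [him])⟩
  · rintro ⟨x, hx, rfl⟩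
    exact ⟨by simp, by simpa using hx⟩

/-- The bottom segment is compact. [folklore] -/
theorem isCompact_bseg (s₀ s₁ : ℝ) : IsCompact {z : ℂ | z.im = 0 ∧ z.re ∈ Icc s₀ s₁} := by
  rw [bseg_eq_image]; exact isCompact_Icc.image continuous_ofReal

/-- A real point of `[s₀, s₁]` lies on the bottom segment. [folklore] -/
theorem ofReal_mem_bseg {s₀ s₁ x : ℝ} (hx : x ∈ Icc s₀ s₁) :
    (x : ℂ) ∈ {z : ℂ | z.im = 0 ∧ z.re ∈ Icc s₀ s₁} :=
  ⟨by simp, by simpa using hx⟩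

/-! ## The discrete arc of a bottom segment -/

/-- **The discrete arc of a bottom segment lies in the first row above it.** If `2δ < H` and the
segment `[s₀, s₁] × {0}` stays `δ` away from the bottom corners, every vertex of its discrete arc
is a site `(m, 1)` with `s₀ ≤ δ m ≤ s₁`. [folklore] -/
theorem discreteArc_boxDomain_subset (hδ : 0 < δ) (hK : 0 < K) (hH2 : 2 * δ < H) {s₀ s₁ : ℝ}
    (hs : s₀ ≤ s₁) (h0 : -K < s₀ - δ) (h1 : s₁ + δ < K) {v : Site 2}
    (hv : v ∈ discreteArc (Ioo (-K) K ×ℂ Ioo 0 H) δ {z : ℂ | z.im = 0 ∧ z.re ∈ Icc s₀ s₁}) :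
    v 1 = 1 ∧ s₀ ≤ δ * v 0 ∧ δ * v 0 ≤ s₁ := by
  have hH : 0 < H := by linarith
  set A : Set ℂ := {z : ℂ | z.im = 0 ∧ z.re ∈ Icc s₀ s₁} with hA
  set p := meshPoint δ v
  obtain ⟨hvb, hdist⟩ := hv
  have hvV : v ∈ meshVertices (Ioo (-K) K ×ℂ Ioo 0 H) δ :=
    meshDomain_subset_meshVertices _ _ (meshBoundary_subset_meshDomain _ _ hvb)
  obtain ⟨⟨hK1, hK2⟩, hv1, hv2⟩ := mem_meshVertices_boxDomain.1 hvV
  have hpre : p.re = δ * v 0 := meshPoint_re δ v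
  have hpim : p.im = δ * v 1 := meshPoint_im δ v
  have hAne : A.Nonempty := ⟨(s₀ : ℂ), ofReal_mem_bseg (show s₀ ∈ Icc s₀ s₁ from ⟨le_rfl, hs⟩)⟩
  have hv1' : (0 : ℝ) ≤ v 1 := by
    have := one_le_of_mul_pos hδ hv1
    exact_mod_cast (show (0 : ℤ) ≤ v 1 by omega)
  -- the foot of the perpendicular is a frontier point
  have hfoot : ((δ * v 0 : ℝ) : ℂ) ∈ frontier (Ioo (-K) K ×ℂ Ioo 0 H) :=
    ofReal_mem_frontier_boxDomain hK hH ⟨hK1.le, hK2.le⟩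
  have hfoot_dist : dist p ((δ * v 0 : ℝ) : ℂ) ≤ δ * v 1 := dist_meshPoint_ofReal_le hδ.le v hv1'
  -- Step 1: the vertex sits above the segment
  have hin : s₀ ≤ δ * v 0 ∧ δ * v 0 ≤ s₁ := by
    by_contra hcon
    have hout : ((δ * v 0 : ℝ) : ℂ) ∉ A := fun h => hcon (by simpa [hA] using h.2)
    have hmem : ((δ * v 0 : ℝ) : ℂ) ∈ frontier (Ioo (-K) K ×ℂ Ioo 0 H) \ A := ⟨hfoot, hout⟩
    have hle : infDist p (frontier (Ioo (-K) K ×ℂ Ioo 0 H) \ A) ≤ δ * v 1 :=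
      (infDist_le_dist_of_mem hmem).trans hfoot_dist
    obtain ⟨a, haA, hda⟩ := (isCompact_bseg s₀ s₁).exists_infDist_eq_dist hAne p
    have hne : p.re ≠ a.re := by
      intro he
      apply hcon
      have := haA.2
      rw [← he, hpre] at this
      exact this
    have hlt : δ * v 1 < dist p a := by
      have := im_lt_dist_of_re_ne haA.1 hne
      rwa [hpim] at this
    have : infDist p A ≤ δ * v 1 := hdist.trans hle
    rw [hda] at this
    linarith
  refine ⟨?_, hin.1, hin.2⟩
  -- Step 2: the vertex is in the first row
  obtain ⟨w, hvw, hnadj⟩ := hvb.2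
  rw [discreteDomainGraph_adj_boxDomain hδ] at hnadj
  have hwV : w ∉ meshVertices (Ioo (-K) K ×ℂ Ioo 0 H) δ := fun h => hnadj ⟨hvw, hvV, h⟩
  rw [mem_meshVertices_boxDomain] at hwV
  obtain ⟨i, hi | hi⟩ := (zdGraph_adj_iff v w).1 hvw
  · -- `w = v + eᵢ`
    fin_cases i
    · exfalso; apply hwV
      simp only [hi, Fin.zero_eta, Pi.add_apply, Pi.single_eq_same, Int.cast_add, Int.cast_one,
        ne_eq, one_ne_zero, not_false_eq_true, Pi.single_eq_of_ne, add_zero]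
      refine ⟨⟨by nlinarith, by nlinarith⟩, hv1, hv2⟩
    · exfalso
      simp only [hi, Fin.mk_one, Pi.add_apply, ne_eq, zero_ne_one, not_false_eq_true,
        Pi.single_eq_of_ne, add_zero, Pi.single_eq_same, Int.cast_add, Int.cast_one] at hwV
      have htop : H ≤ δ * (v 1 + 1) := by
        by_contra h
        push Not at h
        exact hwV ⟨⟨hK1, hK2⟩, by nlinarith, h⟩
      -- the top point above `p` is a frontier point off the segment
      have hq : ((δ * v 0 : ℝ) : ℂ) + H * I ∈ frontier (Ioo (-K) K ×ℂ Ioo 0 H) \ A := by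
        refine ⟨top_mem_frontier_boxDomain hK hH ⟨hK1.le, hK2.le⟩, fun h => ?_⟩
        have := h.1
        simp at this
        exact hH.ne' this
      have hle : infDist p (frontier (Ioo (-K) K ×ℂ Ioo 0 H) \ A) ≤ H - δ * v 1 :=
        (infDist_le_dist_of_mem hq).trans (dist_meshPoint_top_le v hv2.le)
      have hge : δ * v 1 ≤ infDist p A := by
        rw [le_infDist hAne]
        intro a ha
        have := im_le_dist_of_im_eq_zero ha.1 (show 0 ≤ p.im by rw [hpim]; exact hv1.le)
        rwa [hpim] at this
      have := hge.trans (hdist.trans hle)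
      nlinarith
  · -- `v = w + eᵢ`
    fin_cases i
    · exfalso; apply hwV
      have e0 : (w 0 : ℝ) = v 0 - 1 := by
        have := congr_fun hi 0; simp at this; rw [this]; push_cast; ring
      have e1 : (w 1 : ℝ) = v 1 := by
        have := congr_fun hi 1; simp at this; rw [this]
      rw [e0, e1]
      refine ⟨⟨by nlinarith, by nlinarith⟩, hv1, hv2⟩
    · have e0 : (w 0 : ℝ) = v 0 := by
        have := congr_fun hi 0; simp at this; rw [this]
      have e1 : (w 1 : ℝ) = v 1 - 1 := by
        have := congr_fun hi 1; simp at this; rw [this]; push_cast; ring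
      rw [e0, e1] at hwV
      have hle1 : δ * (v 1 - 1) ≤ 0 := by
        by_contra h
        push Not at h
        exact hwV ⟨⟨hK1, hK2⟩, h, by nlinarith⟩
      have h1v := one_le_of_mul_pos hδ hv1
      have : (v 1 : ℝ) - 1 ≤ 0 := by
        by_contra h; push Not at h
        exact absurd (mul_pos hδ h) (not_lt.2 hle1)
      have : v 1 ≤ 1 := by exact_mod_cast (show (v 1 : ℝ) ≤ 1 by linarith)
      omega

/-- **The first row above a bottom segment lies in its discrete arc.** If `2δ ≤ H` and
`[s₀, s₁] ⊆ [-K + δ, K - δ]`, every site `(m, 1)` with `s₀ ≤ δ m ≤ s₁` belongs to the discrete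
arc of `[s₀, s₁] × {0}`. [folklore] -/
theorem mem_discreteArc_boxDomain (hδ : 0 < δ) (hK : 0 < K) (hH2 : 2 * δ ≤ H) {s₀ s₁ : ℝ}
    (h0 : -K + δ ≤ s₀) (h1 : s₁ + δ ≤ K) {v : Site 2} (hv1 : v 1 = 1) (hs0 : s₀ ≤ δ * v 0)
    (hs1 : δ * v 0 ≤ s₁) :
    v ∈ discreteArc (Ioo (-K) K ×ℂ Ioo 0 H) δ {z : ℂ | z.im = 0 ∧ z.re ∈ Icc s₀ s₁} := by
  have hH : 0 < H := by linarith
  set A : Set ℂ := {z : ℂ | z.im = 0 ∧ z.re ∈ Icc s₀ s₁} with hA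
  set p := meshPoint δ v
  have hv1r : (v 1 : ℝ) = 1 := by exact_mod_cast hv1
  have hvV : v ∈ meshVertices (Ioo (-K) K ×ℂ Ioo 0 H) δ := by
    rw [mem_meshVertices_boxDomain, hv1r, mul_one]
    exact ⟨⟨by linarith, by linarith⟩, hδ, by linarith⟩
  have hvD : v ∈ meshDomain (Ioo (-K) K ×ℂ Ioo 0 H) δ := by rwa [meshDomain_boxDomain hδ]
  refine ⟨⟨hvD, v - Pi.single 1 1, ?_, ?_⟩, ?_⟩
  · rw [zdGraph_adj_iff]; exact ⟨1, Or.inr (by simp)⟩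
  · rw [discreteDomainGraph_adj_boxDomain hδ, mem_meshVertices_boxDomain,
      mem_meshVertices_boxDomain]
    rintro ⟨-, -, -, h, -⟩
    simp [hv1] at h
  · -- the distance comparison
    have hfootA : ((δ * v 0 : ℝ) : ℂ) ∈ A := ofReal_mem_bseg ⟨hs0, hs1⟩
    have hle : infDist p A ≤ δ := by
      refine (infDist_le_dist_of_mem hfootA).trans ?_
      have := dist_meshPoint_ofReal_le hδ.le v (by rw [hv1r]; exact zero_le_one)
      rwa [hv1r, mul_one] at this
    refine hle.trans ?_
    have hne : (frontier (Ioo (-K) K ×ℂ Ioo 0 H) \ A).Nonempty := by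
      refine ⟨((δ * v 0 : ℝ) : ℂ) + H * I,
        top_mem_frontier_boxDomain hK hH ⟨by linarith, by linarith⟩, fun h => ?_⟩
      have := h.1
      simp at this
      exact hH.ne' this
    rw [le_infDist hne]
    rintro q ⟨hq, -⟩
    refine le_trans ?_ (le_dist_of_mem_frontier_boxDomain hK hH hq)
    rw [meshPoint_im, meshPoint_re, hv1r, mul_one]
    have habs : |δ * v 0| ≤ K - δ := abs_le.2 ⟨by linarith, by linarith⟩
    exact le_min (le_min le_rfl (by linarith)) (by linarith)

/-! ## Open paths of `Ω_δ` versus open lattice paths in the lattice box -/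

/-- An open path of `Ω_δ` is an open path inside the discrete domain (any domain). [folklore] -/
theorem openConnIn_meshDomain_of_reachable {Ω : Set ℂ} {δ : ℝ} {ω : BondConfig (Site 2)}
    {x y : Site 2} (hx : x ∈ meshDomain Ω δ)
    (h : (openGraph ω ⊓ discreteDomainGraph Ω δ).Reachable x y) :
    ω ∈ openConnIn (meshDomain Ω δ) x y := by
  obtain ⟨W⟩ := h
  induction W with
  | nil => exact openConnIn_refl hx
  | @cons a b c hab W ih =>
    obtain ⟨hω, -, ha, hb⟩ := open_inf_discreteDomainGraph_adj_iff.1 hab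
    exact PlanarDuality.openConnIn_trans (openConnIn_of_adj ha hb hω hab.ne) (ih hb)

/-- **An open lattice path inside the lattice box is an open path of `Ω_δ`** (for a lattice
configuration `ω ⊆ E(ℤ²)`). [folklore] -/
theorem reachable_of_openConnIn_boxDomain (hδ : 0 < δ) {ω : BondConfig (Site 2)}
    (hωE : ω ⊆ (zdGraph 2).edgeSet) {x y : Site 2}
    (h : ω ∈ openConnIn (meshVertices (Ioo (-K) K ×ℂ Ioo 0 H) δ) x y) :
    (openGraph ω ⊓ discreteDomainGraph (Ioo (-K) K ×ℂ Ioo 0 H) δ).Reachable x y := by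
  obtain ⟨hx, hy, ⟨W⟩⟩ := h
  set V := meshVertices (Ioo (-K) K ×ℂ Ioo 0 H) δ
  suffices H' : ∀ (a b : V) (W : ((openGraph ω).induce V).Walk a b),
      (openGraph ω ⊓ discreteDomainGraph (Ioo (-K) K ×ℂ Ioo 0 H) δ).Reachable a b from H' _ _ W
  intro a b W
  induction W with
  | nil => exact SimpleGraph.Reachable.refl _
  | @cons a b c hab W ih =>
    have hab' : (openGraph ω).Adj a b := hab
    obtain ⟨hmem, hne⟩ := (openGraph_adj _ _ _).1 hab'
    have hzd : (zdGraph 2).Adj a b := by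
      have := hωE hmem
      rwa [SimpleGraph.mem_edgeSet] at this
    refine (SimpleGraph.Adj.reachable ?_).trans ih
    refine open_inf_discreteDomainGraph_adj_iff.2 ⟨hmem, meshGraph_adj_boxDomain a.2 b.2 hzd, ?_, ?_⟩
    · rw [meshDomain_boxDomain hδ]; exact a.2
    · rw [meshDomain_boxDomain hδ]; exact b.2

end BoxExhaustion

/-- Registered stub of this support file (part 2 of the box exhaustion): the discrete arc of a bottom
segment lies in the first row above it. [folklore] -/
theorem stub_boxExhaustion_discreteArc :
    ∀ K H δ s₀ s₁ : ℝ, 0 < δ → 0 < K → 2 * δ < H → s₀ ≤ s₁ → -K < s₀ - δ → s₁ + δ < K →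
      ∀ v : Site 2, v ∈ discreteArc (Ioo (-K) K ×ℂ Ioo 0 H) δ {z : ℂ | z.im = 0 ∧ z.re ∈ Icc s₀ s₁} →
        v 1 = 1 ∧ s₀ ≤ δ * v 0 ∧ δ * v 0 ≤ s₁ :=
  fun _ _ _ _ _ hδ hK hH2 hs h0 h1 _ hv => BoxExhaustion.discreteArc_boxDomain_subset hδ hK hH2 hs h0 h1 hv

end Summit.CriticalPhenomena.CardyFormulaZ2.Cruxes.HalfPlaneMarkDensityLaw.SketchLine

end
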